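import Literature.AlgebraicGeometry.Motives.AbelianVarietyCotangentBaseChange
import HarnessLib

/-!
# Base change of the cotangent space of an abelian variety, II: `L ⊗_K T_e^*(A) ≃ T_e^*(A_L)`

Continuation of `Motives/AbelianVarietyCotangentBaseChange`. For an abelian variety `A` over a field
`K` and a field extension `L ⊇ K` we prove that the base-change map
`cotangentBaseChangeMap L A : L ⊗[K] T_e^*(A) → T_e^*(A_L)` is an **isomorphism of `L`-vector spaces**
(Görtz–Wedhorn, *Algebraic Geometry I*, Remark 6.12 (2)–(3), (6.6.2)–(6.6.3), p. 188:
`T_{x'}(X ⊗_k k') ≅ T_x(X) ⊗_k k'` for a `k`-rational point `x` and `x'` over it; dually on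
cotangent spaces), following the printed argument through `L[ε]`-valued points:

* `pointsEquivOfTower` — `A(S) ≃ A_L(S)` for every `L`-algebra `S` (the adjunction
  `Over.map ⊣ Over.pullback`, Görtz–Wedhorn I (4.7); Remark 6.12 (1)), natural in `S`;
* `tangentPtL ψ` / `tangentPtL' ψ` — the `L[ε]`-point `t_ψ : Spec L[ε] → A` of a `K`-linear
  `ψ : T_e^*(A) → L` and its lift `t'_ψ : Spec L[ε] → A_L`, a tangent vector of `A_L` at the origin
  (`tangentPtL'_mem_kerAug`), whose local homomorphism restricted along `pr^*` is `a ↦ a(e) + ψ(dā)ε`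
  (`stalkMapFst_comp_evTangentPtL'`); hence an `L`-linear form `θ` on `T_e^*(A_L)` with
  `θ ∘ Φ = ψ ⊗ 1` (`exists_functional_comp_cotangentToBaseChange`);
* `cotangentBaseChangeMap_injective`, `cotangentBaseChangeMap_bijective` — injectivity (the forms
  `ψ ⊗ 1` separate `L ⊗_K T_e^*(A)`) and bijectivity (both sides have `L`-dimension `dim A`:
  `finrank_cotangent`, `AbelianVariety.dim_baseChange`);
* **`AbelianVariety.cotangentBaseChange L A : L ⊗[K] Cotangent A ≃ₗ[L] Cotangent (A.baseChange L)`**,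
  its naturality `cotangentBaseChange_comp_baseChange_cotangentMap`, the conjugation formula
  `cotangentMap_baseChange_eq_conj` (`T_e^*(u_L) = Φ ∘ (1 ⊗ T_e^*(u)) ∘ Φ⁻¹`) and
  **`det_cotangentMap_baseChange`**: `det T_e^*(u_L) = det T_e^*(u)` in `L`.

Everything is proved (no named facts).

## References

* U. Görtz, T. Wedhorn, *Algebraic Geometry I: Schemes*, 2nd ed. (2020), (4.7), (6.4), Prop. 6.7,
  Remark 6.12 (1)–(3) with (6.6.2)–(6.6.3) (pp. 184–188). [GortzWedhorn2020]
-/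

universe u
open CategoryTheory CategoryTheory.Limits AlgebraicGeometry IsLocalRing TensorProduct

noncomputable section

namespace Literature.AlgebraicGeometry.Motives

namespace AbelianVariety

open scoped MonObj
open AlgPoints

variable {K : Type u} [Field K] (L : Type u) [Field L] [Algebra K L] (A : AbelianVariety K)

attribute [local instance] stalkOriginAlgebra stalkOriginAlgebraOfBase Cotangent.moduleOfBase

/-! ### Points with values in `L`-algebras: the adjunction `Over.map ⊣ Over.pullback` -/

section Adjunction

variable (S : Type u) [CommRing S] [Algebra K S] [Algebra L S] [IsScalarTower K L S]

/-- `Spec S` as a `K`-scheme is `Spec S` over `L` pushed forward along `Spec L → Spec K`, for an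
`L`-algebra `S` (Hartshorne II Ex. 2.7; the case `S = L` is `specOverIsoMapObj`). [folklore] -/
def specOverIsoMapObjOfTower : specOver K S ≅ (Over.map (bcSpec K L)).obj (specOver L S) :=
  Over.isoMk (Iso.refl _) (by
    change 𝟙 (Spec (CommRingCat.of S)) ≫ Spec.map (CommRingCat.ofHom (algebraMap L S)) ≫ bcSpec K L =
      Spec.map (CommRingCat.ofHom (algebraMap K S))
    rw [Category.id_comp, ← Spec.map_comp, ← CommRingCat.ofHom_comp, ← IsScalarTower.algebraMap_eq K L S])

/-- **`A(S) ≃ A_L(S)` for an `L`-algebra `S`**: `S`-valued points of `A` over `K` are `S`-valued points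
of `A_L` over `L` (Görtz–Wedhorn I, (4.7); Mathlib `Over.mapPullbackAdj`; the case `S = L` is
`pointsEquiv`). [folklore] -/
def pointsEquivOfTower : (specOver K S ⟶ A.X) ≃ (specOver L S ⟶ (A.baseChange L).X) :=
  ((specOverIsoMapObjOfTower L S).homCongr (Iso.refl A.X)).trans
    ((Over.mapPullbackAdj (bcSpec K L)).homEquiv (specOver L S) A.X)

/-- The point of `A_L(S)` attached to `P ∈ A(S)` lies over `P`.
[cite: GortzWedhorn2020, Section (4.7) and Remark 6.12 (1) (p. 188)] -/
theorem pointsEquivOfTower_symm_apply_left (Q : specOver L S ⟶ (A.baseChange L).X) :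
    ((pointsEquivOfTower L A S).symm Q).left = Q.left ≫ bcFst L A := by
  rw [bcFst_def]
  simp only [pointsEquivOfTower, Equiv.symm_trans_apply, Iso.homCongr_symm, Iso.homCongr_apply,
    Iso.refl_symm, Iso.refl_hom, Category.comp_id, Over.comp_left]
  erw [Adjunction.homEquiv_counit]
  simp [specOverIsoMapObjOfTower]
  exact Category.id_comp _

/-- The point of `A_L(S)` attached to `P ∈ A(S)` lies over `P`.
[cite: GortzWedhorn2020, Section (4.7) and Remark 6.12 (1) (p. 188)] -/
theorem pointsEquivOfTower_apply_left_comp_bcFst (P : specOver K S ⟶ A.X) :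
    (pointsEquivOfTower L A S P).left ≫ bcFst L A = P.left := by
  rw [← pointsEquivOfTower_symm_apply_left, Equiv.symm_apply_apply]

/-- **Naturality of `A(S) ≃ A_L(S)` in the `L`-algebra `S`.**
[cite: GortzWedhorn2020, Section (4.7) and Remark 6.12 (1) (p. 188)] -/
theorem pointsEquivOfTower_naturality {S' : Type u} [CommRing S'] [Algebra K S'] [Algebra L S']
    [IsScalarTower K L S'] (φ : S →ₐ[L] S') (P : specOver K S ⟶ A.X) :
    pointsEquivOfTower L A S' (specOverMapOfAlgHom (φ.restrictScalars K) ≫ P) =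
      specOverMapOfAlgHom φ ≫ pointsEquivOfTower L A S P := by
  have h1 : (specOverIsoMapObjOfTower L S').inv ≫ specOverMapOfAlgHom (φ.restrictScalars K) =
      (Over.map (bcSpec K L)).map (specOverMapOfAlgHom φ) ≫ (specOverIsoMapObjOfTower L S).inv := by
    apply Over.OverMorphism.ext
    change (𝟙 (Spec (CommRingCat.of S')) : Spec (CommRingCat.of S') ⟶ Spec (CommRingCat.of S')) ≫
        Spec.map (CommRingCat.ofHom (φ.restrictScalars K).toRingHom) =
      Spec.map (CommRingCat.ofHom φ.toRingHom) ≫ (𝟙 (Spec (CommRingCat.of S)))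
    rw [Category.id_comp, Category.comp_id]
    rfl
  simp only [pointsEquivOfTower, Equiv.trans_apply, Iso.homCongr_apply, Iso.refl_hom,
    Category.comp_id]
  rw [← Category.assoc, h1, Category.assoc]
  erw [Adjunction.homEquiv_naturality_left]
  rfl

end Adjunction

/-! ### The `L[ε]`-point of `A` attached to `ψ : T_e^*(A) → L`, and its lift to `A_L` -/

section TangentPoint

open TrivSqZeroExt

variable {L A}
variable (ψ : Cotangent A →ₗ[K] L)

/-- `tangentHomL ψ` is a `K`-algebra map.
[cite: GortzWedhorn2020, (6.4) and Proposition 6.7 (p. 184), Remark 6.12 (2) (p. 188)] -/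
theorem tangentHomL_comp_algebraMap :
    (tangentHomL ψ).comp (stalkOriginAlgebraMap A) = algebraMap K (DualNumber L) := by
  ext c
  · rw [RingHom.comp_apply, fst_tangentHomL_apply, evalOrigin_algebraMap, algebraMap_eq_inl',
      fst_inl]
  · rw [RingHom.comp_apply, snd_tangentHomL_apply, tangentFormL_algebraMap, algebraMap_eq_inl',
      snd_inl]

/-- **The `L[ε]`-valued point `t_ψ : Spec L[ε] → A` (over `K`) at the origin** defined by `ψ`
(Görtz–Wedhorn I, (6.4)). [folklore] -/
def tangentPtL : specOver K (DualNumber L) ⟶ A.X :=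
  ptOver (CommRingCat.ofHom (tangentHomL ψ)) (tangentHomL_comp_algebraMap ψ)

/-- Underlying morphism of `tangentPtL ψ`.
[cite: GortzWedhorn2020, (6.4) and Proposition 6.7 (p. 184), Remark 6.12 (2) (p. 188)] -/
theorem tangentPtL_left : (tangentPtL ψ).left = ptOfStalkHom (CommRingCat.ofHom (tangentHomL ψ)) :=
  ptOver_left _ _

/-- `t_ψ` restricted along `L[ε] → L` is the trivial `L`-point of `A`.
[cite: GortzWedhorn2020, Section (4.7) and Remark 6.12 (1) (p. 188)] -/
theorem specOverMap_aug_comp_tangentPtL :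
    specOverMapOfAlgHom ((dualNumberAug L).restrictScalars K) ≫ tangentPtL ψ = 1 := by
  apply Over.OverMorphism.ext
  change Spec.map (CommRingCat.ofHom ((dualNumberAug L).restrictScalars K).toRingHom) ≫
      (tangentPtL ψ).left = (1 : specOver K L ⟶ A.X).left
  rw [tangentPtL_left, one_left, SpecMap_comp_ptOfStalkHom]
  have h1 : (CommRingCat.ofHom (tangentHomL ψ) : stalkOrigin A ⟶ CommRingCat.of (DualNumber L)) ≫
      CommRingCat.ofHom ((dualNumberAug L).restrictScalars K).toRingHom =
      (CommRingCat.ofHom (evalOrigin A) : stalkOrigin A ⟶ CommRingCat.of K) ≫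
        CommRingCat.ofHom (algebraMap K L) := by
    apply CommRingCat.hom_ext
    ext a
    exact fst_tangentHomL_apply ψ a
  have h2 : ptOfStalkHom (CommRingCat.ofHom (evalOrigin A)) = (specOver K K).hom ≫ unitPt A := by
    change ptOfStalkHom (evAt (R := CommRingCat.of K) (1 : specOver K K ⟶ A.X).left
      (one_left_base _)) = _
    rw [ptOfStalkHom_evAt]
    rfl
  refine (congrArg (ptOfStalkHom (A := A) (R := CommRingCat.of L)) h1).trans ?_
  refine (SpecMap_comp_ptOfStalkHom (A := A) (CommRingCat.ofHom (algebraMap K L))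
    (CommRingCat.ofHom (evalOrigin A))).symm.trans ?_
  rw [h2]
  change Spec.map _ ≫ Spec.map (CommRingCat.ofHom (algebraMap K K)) ≫ unitPt A =
    Spec.map (CommRingCat.ofHom (algebraMap K L)) ≫ unitPt A
  rw [Algebra.algebraMap_self, CommRingCat.ofHom_id, Spec.map_id, Category.id_comp]

/-- **The lift `t'_ψ : Spec L[ε] → A_L` (over `L`) of `t_ψ`** (Görtz–Wedhorn I, Remark 6.12 (1):
`S`-morphisms `Spec K[ε] → X` correspond to `K`-morphisms `Spec K[ε] → X ×_S Spec K`). [folklore] -/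
def tangentPtL' : specOver L (DualNumber L) ⟶ (A.baseChange L).X :=
  pointsEquivOfTower L A (DualNumber L) (tangentPtL ψ)

/-- `t'_ψ` lies in `Ker(A_L(L[ε]) → A_L(L))` (its restriction along `L[ε] → L` is trivial, by
naturality of `A(S) ≃ A_L(S)`).
[cite: GortzWedhorn2020, (6.4) and Proposition 6.7 (p. 184), Remark 6.12 (2) (p. 188)] -/
theorem tangentPtL'_mem_kerAug :
    tangentPtL' ψ ∈ kerAug (A := A.baseChange L) (dualNumberAug L) := by
  rw [mem_kerAug_iff, tangentPtL', ← pointsEquivOfTower_naturality, specOverMap_aug_comp_tangentPtL]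
  change A.pointsEquiv L 1 = 1
  rw [← pointsMulEquiv_apply, map_one]

/-- `t'_ψ` maps the closed point to the origin of `A_L`.
[cite: GortzWedhorn2020, (6.4) and Proposition 6.7 (p. 184), Remark 6.12 (2) (p. 188)] -/
theorem tangentPtL'_base :
    (tangentPtL' ψ).left.base (IsLocalRing.closedPoint (DualNumber L)) = origin (A.baseChange L) :=
  base_eq_origin_of_mem_kerAug (dualNumberAug L) (tangentPtL'_mem_kerAug ψ)

variable (L A) in
/-- Functoriality of `evAt` along the projection: `evAt (s ≫ pr) = pr^* ≫ evAt s`.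
[cite: StacksProject, Tag 01J7 (Lemma 26.13.3: morphisms from spectra of local rings)] -/
theorem evAt_comp_bcFst {R : CommRingCat.{u}} [IsLocalRing R] (s : Spec R ⟶ (A.baseChange L).X.left)
    (hs : s.base (IsLocalRing.closedPoint R) = origin (A.baseChange L))
    (hs' : (s ≫ bcFst L A).base (IsLocalRing.closedPoint R) = origin A) :
    evAt (s ≫ bcFst L A) hs' = stalkMapFst L A ≫ evAt s hs := by
  have key : s ≫ bcFst L A = ptOfStalkHom (stalkMapFst L A ≫ evAt s hs) := by
    conv_lhs => rw [← ptOfStalkHom_evAt s hs]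
    rw [ptOfStalkHom_comp_bcFst]
  haveI : IsLocalHom (stalkMapFst L A ≫ evAt s hs).hom := by
    rw [CommRingCat.hom_comp]; infer_instance
  rw [evAt_congr key hs' (key ▸ hs'), evAt_ptOfStalkHom]

/-- The local homomorphism `𝒪_{A_L,e} → L[ε]` of `t'_ψ`. [folklore] -/
def evTangentPtL' : stalkOrigin (A.baseChange L) ⟶ CommRingCat.of (DualNumber L) :=
  evAt (R := CommRingCat.of (DualNumber L)) (tangentPtL' ψ).left (tangentPtL'_base ψ)

/-- It is local. [folklore] -/
instance isLocalHom_evTangentPtL' : IsLocalHom (evTangentPtL' ψ).hom :=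
  isLocalHom_evAt (R := CommRingCat.of (DualNumber L)) _ _

/-- `ofHom (tangentHomL ψ)` is local (bundled form). [folklore] -/
instance isLocalHom_ofHom_tangentHomL : IsLocalHom (CommRingCat.ofHom (tangentHomL ψ)).hom :=
  isLocalHom_tangentHomL ψ

/-- **Key identity:** `ev_{t'_ψ} ∘ pr^* = (a ↦ a(e) + ψ(da) ε)` — the lift `t'_ψ` composed with
`A_L → A` is `t_ψ`.
[cite: GortzWedhorn2020, (6.4) and Proposition 6.7 (p. 184), Remark 6.12 (2) (p. 188)] -/
theorem stalkMapFst_comp_evTangentPtL' :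
    stalkMapFst L A ≫ evTangentPtL' ψ = CommRingCat.ofHom (tangentHomL ψ) := by
  have h1 : (tangentPtL' ψ).left ≫ bcFst L A = ptOfStalkHom (CommRingCat.ofHom (tangentHomL ψ)) := by
    rw [tangentPtL']
    exact (pointsEquivOfTower_apply_left_comp_bcFst L A _ (tangentPtL ψ)).trans (tangentPtL_left ψ)
  haveI : IsLocalHom (CommRingCat.Hom.hom (stalkMapFst L A ≫ evTangentPtL' ψ)) := by
    rw [CommRingCat.hom_comp]; infer_instance
  apply eq_of_ptOfStalkHom_eq
  rw [← ptOfStalkHom_comp_bcFst, evTangentPtL', ptOfStalkHom_evAt]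
  exact h1

/-- Pointwise form of the key identity.
[cite: GortzWedhorn2020, (6.4) and Proposition 6.7 (p. 184), Remark 6.12 (2) (p. 188)] -/
theorem evTangentPtL'_stalkMapFst (a : stalkOrigin A) :
    evTangentPtL' ψ (stalkMapFst L A a) = tangentHomL ψ a := by
  rw [← CommRingCat.comp_apply, stalkMapFst_comp_evTangentPtL']
  rfl

/-- `ev_{t'_ψ}` is an `L`-algebra map: constants go to constants.
[cite: GortzWedhorn2020, (6.4) and Proposition 6.7 (p. 184), Remark 6.12 (2) (p. 188)] -/
theorem evTangentPtL'_algebraMap (c : L) :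
    evTangentPtL' ψ (stalkOriginAlgebraMap (A.baseChange L) c) = inl c := by
  have h := evAt_comp_algebraMap (R := DualNumber L) (tangentPtL' ψ) (tangentPtL'_base ψ)
  have h' := RingHom.congr_fun h c
  rw [RingHom.comp_apply] at h'
  exact h'

/-- `ev_{t'_ψ}` maps `𝔪_{A_L,e}` into `ε L`: the constant part vanishes.
[cite: GortzWedhorn2020, (6.4) and Proposition 6.7 (p. 184), Remark 6.12 (2) (p. 188)] -/
theorem fst_evTangentPtL'_eq_zero {y : stalkOrigin (A.baseChange L)}
    (hy : y ∈ maximalIdeal (stalkOrigin (A.baseChange L))) : (evTangentPtL' ψ y).fst = 0 := by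
  have h := map_nonunit (evTangentPtL' ψ).hom y hy
  rw [mem_maximalIdeal, mem_nonunits_iff, isUnit_iff_isUnit_fst, isUnit_iff_ne_zero, not_not] at h
  exact h

/-- **The `L`-linear form on `T_e^*(A_L)` defined by `t'_ψ`** extends `ψ` along the base-change map:
there is an additive, `L`-homogeneous `θ : T_e^*(A_L) → L` with `θ(d(pr^* a)) = ψ(da)`
(the `ε`-part of `ev_{t'_ψ}` on `𝔪_{A_L,e}/𝔪²`).
[cite: GortzWedhorn2020, (6.4) and Proposition 6.7 (p. 184), Remark 6.12 (2) (p. 188)] -/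
theorem exists_functional_comp_cotangentToBaseChange :
    ∃ θ : Cotangent (A.baseChange L) →+ L,
      (∀ (c : L) (w : Cotangent (A.baseChange L)), θ (c • w) = c * θ w) ∧
      ∀ x : ↥(maximalIdeal (stalkOrigin A)),
        θ (cotangentToBaseChange L A (Cotangent.mk A x)) = ψ (Cotangent.mk A x) := by
  set ev := evTangentPtL' ψ with hev
  letI inst : Module (stalkOrigin (A.baseChange L)) L :=
    Module.compHom L ((TrivSqZeroExt.fstHom L L L).toRingHom.comp ev.hom)
  have hsmul : ∀ (a : stalkOrigin (A.baseChange L)) (m : L), a • m = (ev a).fst * m := fun _ _ => rfl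
  let f : ↥(maximalIdeal (stalkOrigin (A.baseChange L))) →ₗ[stalkOrigin (A.baseChange L)] L :=
    { toFun := fun y => (ev y).snd
      map_add' := fun y z => by simp only [Submodule.coe_add, map_add, snd_add]
      map_smul' := fun a y => by
        rw [RingHom.id_apply, hsmul, Submodule.coe_smul, smul_eq_mul, map_mul, snd_mul,
          fst_evTangentPtL'_eq_zero ψ y.2, MulOpposite.op_zero, zero_smul, add_zero, smul_eq_mul] }
  have hf : ∀ y z : ↥(maximalIdeal (stalkOrigin (A.baseChange L))), f (y * z) = 0 := by
    intro y z
    change (ev ((y : stalkOrigin (A.baseChange L)) * z)).snd = 0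
    rw [map_mul, snd_mul, fst_evTangentPtL'_eq_zero ψ y.2, fst_evTangentPtL'_eq_zero ψ z.2,
      zero_smul, MulOpposite.op_zero, zero_smul, add_zero]
  refine ⟨(Ideal.Cotangent.lift f hf).toAddMonoidHom, fun c w => ?_, fun x => ?_⟩
  · obtain ⟨y, rfl⟩ := Cotangent.mk_surjective w
    rw [Cotangent.smul_mk]
    change Ideal.Cotangent.lift f hf ((maximalIdeal _).toCotangent _) =
      c * Ideal.Cotangent.lift f hf ((maximalIdeal _).toCotangent y)
    rw [Ideal.Cotangent.lift_toCotangent, Ideal.Cotangent.lift_toCotangent]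
    change (ev (stalkOriginAlgebraMap (A.baseChange L) c * y)).snd = c * (ev y).snd
    rw [map_mul, evTangentPtL'_algebraMap, snd_mul, fst_inl, snd_inl, smul_zero, add_zero,
      smul_eq_mul]
  · rw [cotangentToBaseChange_mk]
    change Ideal.Cotangent.lift f hf ((maximalIdeal _).toCotangent _) = _
    rw [Ideal.Cotangent.lift_toCotangent]
    change (ev (stalkMapFst L A x)).snd = _
    rw [evTangentPtL'_stalkMapFst, snd_tangentHomL_apply, tangentFormL_of_mem ψ x.2]

end TangentPoint

/-! ### The base-change map is an isomorphism -/

/-- **Injectivity of `L ⊗_K T_e^*(A) → T_e^*(A_L)`** (Görtz–Wedhorn I, Remark 6.12 (2), proof: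
every `K`-linear `ψ : T_e^*(A) → L` factors through it, via the tangent vector `t'_ψ` of `A_L`;
and the functionals `ψ ⊗ 1` separate `L ⊗_K T_e^*(A)`). [cite: GortzWedhorn2020, Remark 6.12 (2) (p. 188)] -/
theorem cotangentBaseChangeMap_injective : Function.Injective (cotangentBaseChangeMap L A) := by
  rw [injective_iff_map_eq_zero]
  intro z hz
  have hψ : ∀ ψ : Cotangent A →ₗ[K] L, ψ.liftBaseChange L z = 0 := by
    intro ψ
    obtain ⟨θ, hθs, hθm⟩ := exists_functional_comp_cotangentToBaseChange ψ
    have h : ∀ w : L ⊗[K] Cotangent A, ψ.liftBaseChange L w = θ (cotangentBaseChangeMap L A w) := by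
      intro w
      induction w using TensorProduct.induction_on with
      | zero => rw [map_zero, map_zero, map_zero]
      | tmul c v =>
        obtain ⟨x, rfl⟩ := Cotangent.mk_surjective v
        rw [LinearMap.liftBaseChange_tmul, cotangentBaseChangeMap_tmul, hθs, hθm, smul_eq_mul]
      | add w₁ w₂ h₁ h₂ => rw [map_add, map_add, map_add, h₁, h₂]
    rw [h, hz, map_zero]
  let b := Module.Free.chooseBasis K (Cotangent A)
  let B := Algebra.TensorProduct.basis L b
  refine B.ext_elem_iff.mpr fun i => ?_
  have hco : ∀ w : L ⊗[K] Cotangent A,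
      B.repr w i =
        ((Algebra.linearMap K L) ∘ₗ (Finsupp.lapply i) ∘ₗ (b.repr : Cotangent A →ₗ[K] _ →₀ K)).liftBaseChange
          L w := by
    intro w
    induction w using TensorProduct.induction_on with
    | zero => rw [map_zero, map_zero, Finsupp.zero_apply]
    | tmul c v =>
      rw [Algebra.TensorProduct.basis_repr_tmul, LinearMap.liftBaseChange_tmul, Finsupp.smul_apply,
        Finsupp.mapRange_apply, LinearMap.comp_apply, LinearMap.comp_apply, Algebra.linearMap_apply,
        Finsupp.lapply_apply, LinearEquiv.coe_coe, smul_eq_mul]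
    | add w₁ w₂ h₁ h₂ => rw [map_add, map_add, Finsupp.add_apply, h₁, h₂]
  rw [map_zero, Finsupp.zero_apply, hco, hψ]

/-- `dim_L (L ⊗_K T_e^*(A)) = dim A`.
[cite: GortzWedhorn2020, Remark 6.3 (3) and Remark 6.12 (2)–(3), (6.6.2)–(6.6.3) (p. 188)] -/
theorem finrank_baseChange_cotangent : Module.finrank L (L ⊗[K] Cotangent A) = A.dim := by
  rw [Module.finrank_baseChange, finrank_cotangent]

/-- **`L ⊗_K T_e^*(A) → T_e^*(A_L)` is bijective** (injective, between `L`-vector spaces of the same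
dimension `dim A = dim A_L`; Görtz–Wedhorn I, Remark 6.12 (2)–(3)).
[cite: GortzWedhorn2020, Remark 6.12 (2)–(3), (6.6.2)–(6.6.3) (p. 188)] -/
theorem cotangentBaseChangeMap_bijective : Function.Bijective (cotangentBaseChangeMap L A) := by
  refine ⟨cotangentBaseChangeMap_injective L A, ?_⟩
  exact (LinearMap.injective_iff_surjective_of_finrank_eq_finrank
    (by rw [finrank_baseChange_cotangent, finrank_cotangent, dim_baseChange])).mp
    (cotangentBaseChangeMap_injective L A)

/-- **Base change of the cotangent space: `L ⊗_K T_e^*(A) ≃ T_e^*(A_L)`** as `L`-vector spaces,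
`c ⊗ da ↦ c · d(pr^* a)` (Görtz–Wedhorn I, Remark 6.12 (2)–(3), (6.6.2)–(6.6.3): for a `k`-rational
point `x` and `x' ∈ X ⊗_k k'` over it, `T_{x'}(X ⊗_k k') = T_x(X) ⊗_k k'`; here dually, on cotangent
spaces, at the origin of an abelian variety). [cite: GortzWedhorn2020, Remark 6.12 (2)–(3), (6.6.2)–(6.6.3) (p. 188)] -/
def cotangentBaseChange : L ⊗[K] Cotangent A ≃ₗ[L] Cotangent (A.baseChange L) :=
  LinearEquiv.ofBijective (cotangentBaseChangeMap L A) (cotangentBaseChangeMap_bijective L A)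

/-- The isomorphism is the base-change map.
[cite: GortzWedhorn2020, Remark 6.3 (3) and Remark 6.12 (2)–(3), (6.6.2)–(6.6.3) (p. 188)] -/
@[simp]
theorem cotangentBaseChange_apply (z : L ⊗[K] Cotangent A) :
    cotangentBaseChange L A z = cotangentBaseChangeMap L A z := rfl

/-- `c ⊗ da ↦ c · d(pr^* a)`.
[cite: GortzWedhorn2020, Remark 6.3 (3) and Remark 6.12 (2)–(3), (6.6.2)–(6.6.3) (p. 188)] -/
theorem cotangentBaseChange_tmul_mk (c : L) (x : ↥(maximalIdeal (stalkOrigin A))) :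
    cotangentBaseChange L A (c ⊗ₜ Cotangent.mk A x) =
      c • Cotangent.mk (A.baseChange L) ⟨stalkMapFst L A x, stalkMapFst_mem L A x.2⟩ := by
  rw [cotangentBaseChange_apply, cotangentBaseChangeMap_tmul, cotangentToBaseChange_mk]

variable {A} in
/-- **Naturality:** `T_e^*(u_L) ∘ (L ⊗ T_e^*(A) ≃ T_e^*(A_L)) = (≃) ∘ (1 ⊗ T_e^*(u))`.
[cite: GortzWedhorn2020, Remark 6.3 (3) and Remark 6.12 (2)–(3), (6.6.2)–(6.6.3) (p. 188)] -/
theorem cotangentBaseChange_comp_baseChange_cotangentMap (u : A ⟶ A) :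
    (cotangentBaseChange L A).toLinearMap ∘ₗ (cotangentMap A u).baseChange L =
      cotangentMap (A.baseChange L) (Hom.baseChange L u) ∘ₗ (cotangentBaseChange L A).toLinearMap :=
  cotangentBaseChangeMap_comp_baseChange_cotangentMap L u

variable {A} in
/-- Pointwise naturality: `e ((1 ⊗ T_e^*(u)) t) = T_e^*(u_L) (e t)` — the `(χ, hχ)` shape consumed by the
`hCMisogE` junction (`Transposition/Item6PinMatchDef45`).
[cite: GortzWedhorn2020, Remark 6.3 (3) and Remark 6.12 (2)–(3), (6.6.2)–(6.6.3) (p. 188)] -/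
theorem cotangentBaseChange_baseChange_apply (u : A ⟶ A) (t : L ⊗[K] Cotangent A) :
    cotangentBaseChange L A ((cotangentMap A u).baseChange L t) =
      cotangentMap (A.baseChange L) (Hom.baseChange L u) (cotangentBaseChange L A t) :=
  LinearMap.congr_fun (cotangentBaseChange_comp_baseChange_cotangentMap L u) t

/-- **Existence form** (the binder `hbc` of the `hCMisogE` junction, discharged): there is an `L`-linear
isomorphism `χ : L ⊗_K T_e^*(A) ≃ T_e^*(A_L)` natural in `End A`.
[cite: GortzWedhorn2020, Remark 6.12 (2)–(3), (6.6.2)–(6.6.3) (p. 188)] -/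
theorem exists_cotangentBaseChange_natural :
    ∃ χ : L ⊗[K] Cotangent A ≃ₗ[L] Cotangent (A.baseChange L),
      ∀ (f : End A) (t : L ⊗[K] Cotangent A),
        χ ((cotangentMap A f).baseChange L t) =
          cotangentMap (A.baseChange L) (Hom.baseChange L f) (χ t) :=
  ⟨cotangentBaseChange L A, cotangentBaseChange_baseChange_apply L⟩

variable {A} in
/-- **`T_e^*(u_L)` is the base change of `T_e^*(u)`**, transported along `L ⊗_K T_e^*(A) ≃ T_e^*(A_L)`:
`T_e^*(u_L) = e ∘ (1 ⊗ T_e^*(u)) ∘ e⁻¹`.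
[cite: GortzWedhorn2020, Remark 6.3 (3) and Remark 6.12 (2)–(3), (6.6.2)–(6.6.3) (p. 188)] -/
theorem cotangentMap_baseChange_eq_conj (u : A ⟶ A) :
    cotangentMap (A.baseChange L) (Hom.baseChange L u) =
      (cotangentBaseChange L A).toLinearMap ∘ₗ (cotangentMap A u).baseChange L ∘ₗ
        (cotangentBaseChange L A).symm.toLinearMap := by
  apply LinearMap.ext
  intro w
  have h := LinearMap.congr_fun (cotangentBaseChange_comp_baseChange_cotangentMap L u)
    ((cotangentBaseChange L A).symm w)
  simp only [LinearMap.comp_apply, LinearEquiv.coe_toLinearMap, LinearEquiv.apply_symm_apply] at h ⊢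
  exact h.symm

variable {A} in
/-- **`det T_e^*(u_L) = det T_e^*(u)`** (in `L`): determinants are invariant under base change and
conjugation (Mathlib `LinearMap.det_baseChange`, `LinearMap.det_conj`).
[cite: GortzWedhorn2020, Remark 6.3 (3) and Remark 6.12 (2)–(3), (6.6.2)–(6.6.3) (p. 188)] -/
theorem det_cotangentMap_baseChange (u : A ⟶ A) :
    LinearMap.det (cotangentMap (A.baseChange L) (Hom.baseChange L u)) =
      algebraMap K L (LinearMap.det (cotangentMap A u)) := by
  rw [cotangentMap_baseChange_eq_conj, LinearMap.det_conj, LinearMap.det_baseChange]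

end AbelianVariety
end Literature.AlgebraicGeometry.Motives

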